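import Literature.MathematicalPhysics.QuantumFieldTheory.Balaban1983to89.B9Ineq3137LocalSup
import Literature.MathematicalPhysics.QuantumFieldTheory.Balaban1983to89.B9Eq315QTorus
import Literature.MathematicalPhysics.QuantumFieldTheory.Balaban1983to89.B11Eq98V0primeCurrentSlots
import Literature.MathematicalPhysics.QuantumFieldTheory.Balaban1983to89.B9Eq311L2Pairing
import Literature.MathematicalPhysics.QuantumFieldTheory.Balaban1983to89.B9Eq383QSemiLocal
import Literature.MathematicalPhysics.QuantumFieldTheory.Balaban1983to89.B9Thm37GlueTorus
import Literature.MathematicalPhysics.QuantumFieldTheory.Balaban1983to89.B9Eq316TowerFlatIsOneStep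
import Literature.MathematicalPhysics.QuantumFieldTheory.Balaban1983to89.B9Eq316TowerFlatIsOneStep

/-!
# T. Bałaban, *Propagators for lattice gauge theories in a background field*, Commun. Math. Phys. **99** (1985) 389–434 [Balaban1985BackgroundPropagators]
# (3.134) p. 422 *«Let us define ⟨A,Δ⁽²⁾A⟩ = 2⟨HC⁽²⁾(A),J⟩»*, (3.136) p. 422 *«Δ⁽²⁾A = Σ_{j=1}^{k} Σ_{b∈Λ_j} (Lʲη)^{d+1} tr (δ∕δA) C_j⁽²⁾(A,b)(H\*J)(b)»*, read
# against T. Bałaban, *Averaging operations for lattice gauge theories*, Commun. Math. Phys. **98** (1985) 17–51 [Balaban1985Averaging] (136)–(138) p. 39,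
# (141) p. 39, p. 24, p. 34: **BAŁABAN's `Δ⁽²⁾` ON A TORUS AS A `ℂ`-LINEAR OPERATOR, FOR AN ARBITRARY COEFFICIENT FIELD — THE CONSTRUCTION, THE
# POLARISED (3.136) IDENTITY (regime-free algebra), THE DIAGONAL `= 2·C_k⁽²⁾` AT THE PERIODIC EXTENSION UNDER [4] Prop. 5's REGIME ((3.134) literally),
# AND THE COUNTING ∕ BOX GEOMETRY OF THE TORUS OF BLOCKS** («Y17a», row (D4) OWNER lineage `b2b-balaban-beta-an4`, gen 114; the object of OFFER
# O-an4-g113-1 — first brick of the assembly (R4) of memo §25 (iv))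

CITATION HEADER (lean-in-tree rule 2026-08-18).  Audit cell `pub-balaban`, BINDER row (D4) (`RemainderConst` leaves for Bałaban's split), OWNER lineage
`b2b-balaban-beta-an4`, gen 114.  [Balaban1985BackgroundPropagators] (B9 = [5]; held `paper:balaban1985-cmp99-background-propagators`, journal page = PDF
page + 388) (3.11) p. 392, (3.15) p. 393, (3.134)–(3.137) pp. 422–423 (re-read first-hand this generation: p. 422 «Let us define ⟨A,Δ⁽²⁾A⟩ = 2⟨HC⁽²⁾(A),J⟩.
(3.134) … To find bounds for the operator Δ⁽²⁾ let us write it in the form Δ⁽²⁾A = ΣΣ(Lʲη)^{d+1} tr (δ∕δA)C_j⁽²⁾(A,b)(H\*J)(b) (3.136)»); [Balaban1985Averaging]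
(B7 = [4]; `paper:balaban1985-cmp98-averaging`, journal page = PDF page + 16) (136)–(138) p. 39, (141) p. 39, (149) p. 40, p. 24 (after (43)), p. 34 (after (109)),
(52) p. 26, (145) p. 39, (155) p. 41 — as quoted in `B7Eq136SecondOrder` ∕ `B9Ineq3137LocalSup` ∕ `B7LocalityGeneral`; [Balaban1985Variational] (B11 =
[15]) (56) p. 286 (polarisation).  Composed BY NAME: p06's `B7Eq136SecondOrder.CCovIter2` ∕ `CCovIter2_ins_eq` ∕ `hasFDerivAt_CCovIter2_ins`, r06's
`B9Ineq3137LocalSup.CCovIter_congr`, b07∕p06's `B7Prop5Flat.agreeOn_insCfg_restr`, `B12Ineq417Flat.boxBonds`, NE9's `B9Eq315QTorus.perCfg` ∕ `perSite`,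
the OWNER t4-ne9's `B9Eq383QSemiLocal.blockCoord_perSite_of_inBox`, an2's `B11Eq98V0primeCurrentSlots.rieszτ` ∕ `trace_rieszτ_mul`, Mathlib.  Nothing of print
is asserted here.

WHY THIS FILE («Y17a»).  Row (D4)'s NODE D at the origin displays ONE analytic letter — print's (3.137) sentence for `Δ⁽²⁾` («Y13a∕b∕c», this gen).  To
SUPPLY it one needs Bałaban's `Δ⁽²⁾` AS A TERM on the tower's carriers.  Print defines it by its quadratic form (3.134) and computes it by (3.136) from the
second-order term `C⁽²⁾` of the averaging and the coefficients `(H\*J)(b)`.  THIS FILE builds the operator for an ARBITRARY coefficient field `K` on the coarse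
bonds (the budget of `K = H̃\*J` is «Y14»; the final junction is the successor «Y17c») and an arbitrary flat background `U₀` (print: the periodic extension of
the tower background):
* §1 **`exists_delta2_of_coeff`** (REGIME-FREE algebra; fine torus `P`, coarse torus `m`, fibre `φ : W ≃ 𝔸`, trace `τ` with `τ(XY) = τ(YX)` and
  `⟪φ⁻¹X, φ⁻¹Y⟫ = τ(X*Y)`, bond-variable scale `η`, pairing weight `c₀ ≠ 0`): THERE IS a `ℂ`-linear `Δ⁽²⁾` on the fine bond fields with, for all `A, δA`,
  `Σ_b c₀τ(φ(δA(b))φ((Δ⁽²⁾A)(b))) = Σ_c τ(B_c(χ_cA, χ_cδA)·K(c))`, `B_c = D²[C_k(U₀, ins_{S_c}·)(c)](0)` the polarisation of [4] (136) on the chart `𝔸^{S_c}` of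
  the box of `c`, `χ_c(A) = (η·φ∘A)~|_{S_c}` (periodic extension restricted) — (3.136) POLARISED, the left side being the bilinear trace pairing (3.11) with
  weight `c₀`; construction `(Δ⁽²⁾A)(b) = c₀⁻¹φ⁻¹(ρ(X ↦ Σ_c τ(B_c(χ_cA, χ_c(δ_bφ⁻¹X))K(c))))`, `ρ` the dualising map `rieszτ`;
* §2 **`polar_diag_eq_two_smul_CCovIter2`** ([4] Prop. 5's regime at `U₀`): `B_c(B|_S, B|_S) = 2·C_j⁽²⁾(U₀, B)(c)` for EVERY flat field `B` (p06's slice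
  identity + r06's locality ∕ the chart of «Y16») — so §1 at `δA = A` IS (3.134) *«⟨A,Δ⁽²⁾A⟩ = 2⟨HC⁽²⁾(A),J⟩»* with `C⁽²⁾` the torus second-order term;
* §3 counting and box geometry of the torus of blocks: `sum_indicator_two_blocks_le` (at most `2d` coarse bonds see a block), `perSite_val_cast`,
  **`card_filter_bondsIn_perSite_le`** (at most `2^d` flat copies of a torus bond in a box of sides `< 2P`), `loK_eq_cornerSite` ∕ `bondHiK_eq_bondHi` (the
  box of (136) IS the one-step box of block size `Lᵏ`), `blockCoord_of_mem_boxBonds` (a flat bond of the box of `c` reads in the block `c₋` or `c₊`),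
  `bondHiK_lt_loK_add`, `tdist1_two_blocks_le` (`d₁ ≤ d` between the two blocks).

HONEST SCOPE.  §1 is [folklore] linear algebra (the operator of a bilinear form through the dualising map of the trace pairing); §2 composes p06's and r06's
theorems BY NAME; §3 is [folklore] counting.  NO estimate of [5] is proved here ((3.137) is «Y17b»); `(H\*J)` is the letter `K`; the background `U₀` and [4]
Prop. 5's regime ((52), (145), (155) at a witness radius) are HYPOTHESES; the identification of `U₀` with the periodic extension of the tower background and of
`η, c₀` with `Lᵏη = 1`, `c₀ = η^d` is the consumer's.  This is an OBJECT on the cell's MODEL carriers (NE9's torus tower), NOT Bałaban's multiscale `Δ⁽²⁾` on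
`𝔅` (one level `j = k` only), NOT (3.135)'s `Δ⁽²⁾_π`, NOT (3.138).  Row (D4) class UNCHANGED (instance 0∕1; critical-path width 0 = NODE O; D4 DISCHARGE NO
DATE); NOT B12 Thm 2, NOT BetaPertH, NOT continuum, NOT Clay.  HONEST DEPENDENCY (cell line): continuum YM on T⁴ ⇐ BetaPertH ∧ nine spine estimates (0/9
proved); BetaPertH ⇐ (D1) ∧ (D4) ∧ CAP+tail; G-an2-4 gates asym, D1 and NE2/3/4.  NEW file; nothing modified; 0 `def`; standard axioms; no `sorry`.
Net new unproved facts: 0.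
-/

noncomputable section

open scoped BigOperators InnerProductSpace ComplexConjugate

namespace Literature.MathematicalPhysics.QuantumFieldTheory.Balaban1983to89.Beta.RemainderDelta2TorusForm

open B7Prop1Local (AgreeOn InBox loK bondHiK)
open B7Prop3Flat (insCfg)
open B7Prop5Flat (restr)
open B7Prop5GeneralInduction (CCovIter)
open B7Eq136SecondOrder (CCovIter2)
open B12Ineq417Flat (boxBonds)
open B9SectCLatticeCarrier (Bond bpos)
open B4Sect5Torus (TSite)
open B9Eq315QTorus (perCfg perCfg_apply perSite)
open B9Eq311L2Pairing (WL2)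
open B11Eq98V0primeCurrentSlots (rieszτ trace_rieszτ_mul)

/-! ## §1  The operator of (3.134) ∕ (3.136) on a torus, for an arbitrary coefficient field `K` — regime-free algebra -/

section Construction

variable {d : ℕ} (L : ℕ) (k : ℕ) (P : Fin d → ℕ) [∀ i, NeZero (P i)] (m : Fin d → ℕ)
  {𝔸 : Type*} [CStarAlgebra 𝔸]
  {W : Type*} [NormedAddCommGroup W] [InnerProductSpace ℂ W] [FiniteDimensional ℂ W] (φ : W ≃ₗ[ℂ] 𝔸)
  (τ : 𝔸 →ₗ[ℂ] ℂ) (η : ℂ) (U₀ : B7Prop1Explicit.Site d → Fin d → 𝔸ˣ) (K : Bond d m → 𝔸) (c₀ : ℂ)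

/-- **BAŁABAN's `Δ⁽²⁾` OF (3.134) ∕ (3.136) ON A TORUS, AS A `ℂ`-LINEAR OPERATOR, FOR AN ARBITRARY COEFFICIENT FIELD** (regime-free algebra).  Data: a
fine torus `P`, a coarse torus `m` (the blocks), a flat background `U₀` on `ℤ^d` (print: the periodic extension of the tower background), the bond-variable
scale `η` (the field entering the averaging is `ηA`, [4] (127)), a coefficient field `K` on the coarse bonds (print: `(H\*J)(b)`, `b ∈ Λ_k`), the fibre
`φ : W ≃ 𝔸`, the trace `τ` and the weight `c₀` of the fine pairing (3.11).  For each coarse bond `c = (y, κ)` let `S_c` be the bonds of the box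
`B^k(c₋) ∪ B^k(c₊)` (`boxBonds L k y κ`, `y` read in `ℤ^d`), `B_c := D²[C_k(U₀, ins_{S_c} ·)(c)](0)` the polarisation of the second-order term ([4] (136);
`B7Eq136SecondOrder`), `χ_c(A) := (η·φ∘A)~|_{S_c}` the chart of a torus field (periodic extension restricted to the box).  THEN there is a `ℂ`-linear
`Δ⁽²⁾` on the fine bond fields with, for all `A, δA`:
`Σ_b c₀·τ(φ(δA(b))·φ((Δ⁽²⁾A)(b))) = Σ_c τ(B_c(χ_c A, χ_c δA)·K(c))` — (3.136) POLARISED: *«⟨δA, Δ⁽²⁾A⟩ = Σ_j Σ_{b∈Λ_j} (Lʲη)^{d+1} tr (δ∕δA)C_j⁽²⁾(A,b)(H\*J)(b)»*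
at the top level, the left side being the bilinear trace pairing (3.11) with weight `c₀`.  Construction: `(Δ⁽²⁾A)(b) = c₀⁻¹·φ⁻¹(ρ(X ↦ Σ_c τ(B_c(χ_cA, χ_c(δ_bφ⁻¹X))·K(c))))`
with `ρ` the dualising map of the trace pairing (`B11Eq98V0primeCurrentSlots.rieszτ`). [cite: Balaban1985BackgroundPropagators, (3.134)–(3.136) p.422, (3.11) p.392]
[cite: Balaban1985Averaging, (136)–(138) p.39, (127) p.37] -/
theorem exists_delta2_of_coeff (hc₀ : c₀ ≠ 0) (hτ₂ : ∀ X Y : 𝔸, τ (X * Y) = τ (Y * X))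
    (hφτ : ∀ X Y : 𝔸, ⟪φ.symm X, φ.symm Y⟫_ℂ = τ (star X * Y)) :
    ∃ D2 : (Bond d P → W) →ₗ[ℂ] (Bond d P → W),
      ∀ A δA : Bond d P → W,
        ∑ b : Bond d P, c₀ * τ (φ (δA b) * φ (D2 A b)) =
          ∑ c : Bond d m, τ
            (fderiv ℂ (fderiv ℂ (fun a' : ↥(boxBonds L k (fun i => ((c.1 i : ℕ) : ℤ)) c.2) → 𝔸 =>
                CCovIter L U₀ (insCfg (boxBonds L k (fun i => ((c.1 i : ℕ) : ℤ)) c.2) a') k (fun i => ((c.1 i : ℕ) : ℤ)) c.2)) 0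
              (restr (boxBonds L k (fun i => ((c.1 i : ℕ) : ℤ)) c.2) (perCfg P fun b => η • φ (A b)))
              (restr (boxBonds L k (fun i => ((c.1 i : ℕ) : ℤ)) c.2) (perCfg P fun b => η • φ (δA b))) * K c) := by
  classical
  haveI : FiniteDimensional ℂ 𝔸 := LinearEquiv.finiteDimensional φ
  -- notation for the pieces
  set z : Bond d m → B7Prop1Explicit.Site d := fun c i => ((c.1 i : ℕ) : ℤ) with hz
  -- the chart of a torus field at the coarse bond `c` (linear)
  let χ : (c : Bond d m) → (Bond d P → W) →ₗ[ℂ] (↥(boxBonds L k (z c) c.2) → 𝔸) := fun c =>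
    { toFun := fun A => restr (boxBonds L k (z c) c.2) (perCfg P fun b => η • φ (A b))
      map_add' := fun A A' => by
        funext s; simp [restr, perCfg_apply, smul_add]
      map_smul' := fun t A => by
        funext s; simp [restr, perCfg_apply, smul_comm η t] }
  -- the polarisation of the second-order term at `c`
  let Bc : (c : Bond d m) → (↥(boxBonds L k (z c) c.2) → 𝔸) →L[ℂ] (↥(boxBonds L k (z c) c.2) → 𝔸) →L[ℂ] 𝔸 := fun c =>
    fderiv ℂ (fderiv ℂ (fun a' : ↥(boxBonds L k (z c) c.2) → 𝔸 => CCovIter L U₀ (insCfg (boxBonds L k (z c) c.2) a') k (z c) c.2)) 0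
  -- `τ(· K(c))` as a continuous functional
  let τK : Bond d m → 𝔸 →L[ℂ] ℂ := fun c => LinearMap.toContinuousLinearMap (τ ∘ₗ LinearMap.mulRight ℂ (K c))
  -- the functional `X ↦ Σ_c τ(B_c(χ_c A, χ_c(δ_b φ⁻¹X)) K c)` — linear in `A`
  let ℓ : Bond d P → (Bond d P → W) →ₗ[ℂ] (𝔸 →L[ℂ] ℂ) := fun b =>
    ∑ c : Bond d m,
      { toFun := fun A => (τK c).comp (((Bc c) (χ c A)).comp
          (LinearMap.toContinuousLinearMap ((χ c) ∘ₗ LinearMap.single ℂ (fun _ : Bond d P => W) b ∘ₗ φ.symm.toLinearMap)))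
        map_add' := fun A A' => by
          ext X; simp only [map_add, add_apply, ContinuousLinearMap.coe_comp, Function.comp_apply,
            ContinuousLinearMap.add_comp, ContinuousLinearMap.comp_add]
        map_smul' := fun t A => by
          ext X; simp only [map_smul, smul_apply, ContinuousLinearMap.coe_comp, Function.comp_apply,
            ContinuousLinearMap.smul_comp, ContinuousLinearMap.comp_smul, RingHom.id_apply] }
  -- the operator, bond by bond
  let D2b : Bond d P → (Bond d P → W) →ₗ[ℂ] W := fun b =>
    (c₀⁻¹ • φ.symm.toLinearMap) ∘ₗ (rieszτ φ).toLinearMap ∘ₗ ℓ b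
  refine ⟨LinearMap.pi D2b, fun A δA => ?_⟩
  have hτc : Continuous τ := by
    haveI : FiniteDimensional ℂ 𝔸 := LinearEquiv.finiteDimensional φ
    exact τ.continuous_of_finiteDimensional
  -- bond by bond: `c₀·τ(φ(δA b)·φ((Δ⁽²⁾A)(b))) = ℓ_b(A)(φ(δA b))`
  have hb : ∀ b : Bond d P, c₀ * τ (φ (δA b) * φ (LinearMap.pi D2b A b)) = ℓ b A (φ (δA b)) := by
    intro b
    have h1 : φ (LinearMap.pi D2b A b) = c₀⁻¹ • rieszτ φ (ℓ b A) := by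
      simp [D2b, LinearMap.pi_apply, map_smul]
    rw [h1, mul_smul_comm, map_smul, smul_eq_mul, ← mul_assoc, mul_inv_cancel₀ hc₀, one_mul, hτ₂,
      ← ContinuousLinearMap.coe_coe]
    have := trace_rieszτ_mul φ (LinearMap.toContinuousLinearMap τ) (fun X Y => by simpa using hφτ X Y) (ℓ b A) (φ (δA b))
    simpa using this
  simp_rw [hb]
  -- unfold `ℓ_b(A)(φ(δA b))` and exchange the sums
  have hℓ : ∀ b : Bond d P, ℓ b A (φ (δA b)) =
      ∑ c : Bond d m, τ ((Bc c) (χ c A) (χ c (Pi.single b (δA b))) * K c) := by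
    intro b
    simp only [ℓ, LinearMap.coe_sum, Finset.sum_apply, LinearMap.coe_mk, AddHom.coe_mk, FunLike.coe_sum,
      ContinuousLinearMap.coe_comp, Function.comp_apply, LinearMap.coe_toContinuousLinearMap', LinearMap.coe_comp,
      LinearEquiv.coe_coe, LinearEquiv.symm_apply_apply, LinearMap.coe_single, τK, LinearMap.mulRight_apply]
  simp_rw [hℓ]
  rw [Finset.sum_comm]
  refine Finset.sum_congr rfl fun c _ => ?_
  -- linearity in the variation: `Σ_b B_c(χ_c A, χ_c(δ_b δA(b))) = B_c(χ_c A, χ_c δA)`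
  have hsum : ∑ b : Bond d P, (Bc c) (χ c A) (χ c (Pi.single b (δA b))) = (Bc c) (χ c A) (χ c δA) := by
    rw [← map_sum, ← map_sum]
    congr 1
    congr 1
    exact (Finset.univ_sum_single δA)
  calc ∑ b : Bond d P, τ ((Bc c) (χ c A) (χ c (Pi.single b (δA b))) * K c)
      = τ ((∑ b : Bond d P, (Bc c) (χ c A) (χ c (Pi.single b (δA b)))) * K c) := by rw [Finset.sum_mul, map_sum]
    _ = τ ((Bc c) (χ c A) (χ c δA) * K c) := by rw [hsum]
    _ = _ := rfl

end Construction

/-! ## §2  Under [4] Prop. 5's regime: the diagonal of the polarisation IS `2·C_k⁽²⁾` at the periodic extension ((3.134) literally) -/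

section Regime

open B7Prop2Explicit (AvgClosed pdev C0 c2')
open B7Prop3Flat (c3)
open B7Prop5GeneralLevels (thetaGen C3Gen)
open B7Prop5GeneralOperators (kerQdd)
open B9Ineq3137LocalSup (boxProj ineq149_secondOrder_local)

variable {d : ℕ} {𝔸 : Type*} [NormedRing 𝔸] [NormedAlgebra ℂ 𝔸] [CompleteSpace 𝔸] [NormOneClass 𝔸]

variable (L : ℕ) (hL : 2 ≤ L) {G : Subgroup 𝔸ˣ} (hG : AvgClosed d L G) (k : ℕ)
  (U₀ : B7Prop1Explicit.Site d → Fin d → 𝔸ˣ) (hU₀ : ∀ x κ, U₀ x κ ∈ G) {α₀ : ℝ} (hα : 0 < α₀)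
  (hα3 : C0 d * α₀ ≤ 1 / 3) (hα4 : 4 * α₀ ≤ c2' d L) (h52 : pdev U₀ < α₀ * (((L : ℝ) ^ k)⁻¹) ^ 2)
  {b : ℝ} (hb : 0 < b)
  (hsmall : Real.exp (4 * (800 * ((d : ℝ) + 1) ^ 2 * ((d : ℝ) + 4)) * α₀)
    * (1 + 8 * (131072 * ((d : ℝ) + 1) ^ 2) * ((L : ℝ) ^ k * b)) ≤ 2)
  (hc₃ : 4 * ((L : ℝ) ^ k * b) < c3 d L)
  (h145 : 8 * d * thetaGen d L α₀ * (L : ℝ)⁻¹ ^ 4 ≤ 1)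
  (h155 : (2 * (L : ℝ) - 1) * (L : ℝ)⁻¹ ^ 2 + 2 * d * thetaGen d L α₀ * (L : ℝ)⁻¹ ^ 3
    + 1 / 8 * (1 + 2 * d * thetaGen d L α₀ * (L : ℝ)⁻¹ ^ 2 + 2 * d * C3Gen d L * ((L : ℝ) ^ k * b)) * (L : ℝ)⁻¹ ^ 2 ≤ 1)

include hL hG hU₀ hα hα3 hα4 h52 hb hsmall hc₃ in
/-- **THE DIAGONAL OF THE POLARISATION IS `2·C_j⁽²⁾`, FOR EVERY FIELD** ([4] Prop. 5's regime at the background `U₀`): with `S = boxBonds L j z κ` and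
`B_c = D²[C_j(U₀, ins_S ·)(c)](0)`, `B_c(B|_S, B|_S) = 2·C_j⁽²⁾(U₀, B)(c)` — p06's `CCovIter2_ins_eq` (the slice definition is the diagonal) composed with
the chart of «Y16» (`C_j⁽²⁾(U₀, B)(c) = C_j⁽²⁾(U₀, ins_S(B|_S))(c)`, r06's locality); so §1's identity at `δA = A` reads (3.134) LITERALLY:
`⟨A, Δ⁽²⁾A⟩ = 2·Σ_c τ(C_k⁽²⁾(U₀, ηÃ)(c)·K(c))` = *«⟨A,Δ⁽²⁾A⟩ = 2⟨HC⁽²⁾(A),J⟩»* with `K = H\*J`. [cite: Balaban1985BackgroundPropagators, (3.134) p.422]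
[cite: Balaban1985Averaging, (136)–(137) p.39, p.34] [cite: Balaban1985Variational, (56) p.286] -/
theorem polar_diag_eq_two_smul_CCovIter2 {j : ℕ} (hj : j ≤ k) (B : B7Prop1Explicit.Site d → Fin d → 𝔸)
    (z : B7Prop1Explicit.Site d) (κ : Fin d) :
    fderiv ℂ (fderiv ℂ (fun a' : ↥(boxBonds L j z κ) → 𝔸 => CCovIter L U₀ (insCfg (boxBonds L j z κ) a') j z κ)) 0
        (restr (boxBonds L j z κ) B) (restr (boxBonds L j z κ) B) = (2 : ℂ) • CCovIter2 L U₀ B j z κ := by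
  have h1 := B7Eq136SecondOrder.CCovIter2_ins_eq L hL hG k U₀ hU₀ hα hα3 hα4 h52 hb hsmall hc₃ (boxBonds L j z κ) hj z κ
    (restr (boxBonds L j z κ) B)
  have h2 : CCovIter2 L U₀ B j z κ = CCovIter2 L U₀ (insCfg (boxBonds L j z κ) (restr (boxBonds L j z κ) B)) j z κ := by
    have hslice : (fun t : ℂ => CCovIter L U₀ (t • B) j z κ) =
        fun t : ℂ => CCovIter L U₀ (t • insCfg (boxBonds L j z κ) (restr (boxBonds L j z κ) B)) j z κ := by
      funext t
      exact B9Ineq3137LocalSup.CCovIter_congr L (le_trans (by norm_num) hL) j z κ (fun _ _ _ _ => rfl) fun x μ hx hxe =>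
        congrArg (fun X : 𝔸 => t • X) (B7Prop5Flat.agreeOn_insCfg_restr (loK L j z) (bondHiK L j z κ) B x μ hx hxe)
    rw [B7Eq136SecondOrder.CCovIter2_def, B7Eq136SecondOrder.CCovIter2_def, hslice]
  rw [h2, h1, smul_smul, mul_inv_cancel₀ (two_ne_zero), one_smul]

end Regime

/-! ## §3  Counting and box geometry on the torus of blocks -/

section Geometry

open B7Prop5Flat (BondIn bondsIn mem_bondsIn)
open B9SectCLatticeCarrier (shift unshift)
open B9Eq319QprimeTorus (fineP blockCoord)
open B9Eq383QSemiLocal (blockCoord_perSite_of_inBox)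
open B5TorusCover (UT)
open B9Thm37GlueTorus (tdist1 tdist1_comm tdist1_self)
open B4Sect5Torus (ccoord)

variable {d : ℕ}

/-! ### Counting: coarse bonds whose box sees a block; flat copies of a torus bond inside a box -/

/-- At most `2d` coarse bonds `c = (y′, κ)` have a given block `y` as one of their two blocks `y′`, `y′ + e_κ`:
`Σ_c 𝟙[c₋ = y ∨ c₊ = y]·M ≤ 2d·M` for `M ≥ 0` — the «several j-blocks surrounding Δ(y)» of (3.137), counted. [cite: Balaban1985BackgroundPropagators, (3.137) p.423] [cite: Balaban1985Averaging, (141) p.39] -/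
theorem sum_indicator_two_blocks_le {m : Fin d → ℕ} [∀ i, NeZero (m i)] (y : TSite d m) {M : ℝ} (hM : 0 ≤ M) :
    ∑ c : Bond d m, (if c.1 = y ∨ shift c.2 c.1 = y then M else 0) ≤ 2 * d * M := by
  classical
  have h1 : ∀ c : Bond d m, (if c.1 = y ∨ shift c.2 c.1 = y then M else 0) ≤
      (if c.1 = y then M else 0) + (if shift c.2 c.1 = y then M else 0) := by
    intro c
    by_cases ha : c.1 = y ∨ shift c.2 c.1 = y
    · rw [if_pos ha]
      rcases ha with ha | hb
      · rw [if_pos ha]; exact le_add_of_nonneg_right (by split_ifs <;> [exact hM; exact le_rfl])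
      · rw [if_pos hb]; exact le_add_of_nonneg_left (by split_ifs <;> [exact hM; exact le_rfl])
    · rw [if_neg ha]
      exact add_nonneg (by split_ifs <;> [exact hM; exact le_rfl]) (by split_ifs <;> [exact hM; exact le_rfl])
  refine (Finset.sum_le_sum fun c _ => h1 c).trans ?_
  rw [Finset.sum_add_distrib, ← Finset.sum_filter, ← Finset.sum_filter, Finset.sum_const, Finset.sum_const, nsmul_eq_mul, nsmul_eq_mul]
  have hc1 : ((Finset.univ.filter fun c : Bond d m => c.1 = y).card : ℝ) ≤ d := by
    have : (Finset.univ.filter fun c : Bond d m => c.1 = y) = Finset.univ.image fun κ : Fin d => ((y, κ) : Bond d m) := by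
      ext c
      simp only [Finset.mem_filter, Finset.mem_univ, true_and, Finset.mem_image]
      constructor
      · intro h; exact ⟨c.2, by rw [← h]⟩
      · rintro ⟨κ, rfl⟩; rfl
    rw [this]
    have h := Finset.card_image_le (s := (Finset.univ : Finset (Fin d))) (f := fun κ : Fin d => ((y, κ) : Bond d m))
    rw [Finset.card_univ, Fintype.card_fin] at h
    exact_mod_cast h
  have hc2 : ((Finset.univ.filter fun c : Bond d m => shift c.2 c.1 = y).card : ℝ) ≤ d := by
    have : (Finset.univ.filter fun c : Bond d m => shift c.2 c.1 = y) = Finset.univ.image fun κ : Fin d => ((unshift κ y, κ) : Bond d m) := by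
      ext c
      simp only [Finset.mem_filter, Finset.mem_univ, true_and, Finset.mem_image]
      constructor
      · intro h
        refine ⟨c.2, ?_⟩
        have : unshift c.2 y = c.1 := by rw [← h, B9SectCLatticeCarrier.unshift_shift]
        rw [this]
      · rintro ⟨κ, rfl⟩
        exact B9SectCLatticeCarrier.shift_unshift κ y
    rw [this]
    have h := Finset.card_image_le (s := (Finset.univ : Finset (Fin d))) (f := fun κ : Fin d => ((unshift κ y, κ) : Bond d m))
    rw [Finset.card_univ, Fintype.card_fin] at h
    exact_mod_cast h
  nlinarith


/-- The torus reading of a flat site, coordinatewise: `((perSite P x) i : ℤ) = x_i mod P_i` (the periodic extension of [5] (3.15) ∕ [4] (1)). [cite: Balaban1985Averaging, (1) p.17] [cite: Balaban1985BackgroundPropagators, (3.15) p.393] -/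
theorem perSite_val_cast (P : Fin d → ℕ) [∀ i, NeZero (P i)] (x : B7Prop1Explicit.Site d) (i : Fin d) :
    (((perSite P x) i : ℕ) : ℤ) = x i % (P i : ℤ) := by
  have hP : (0 : ℤ) < (P i : ℤ) := by exact_mod_cast Nat.pos_of_ne_zero (NeZero.ne (P i))
  show (((x i % (P i : ℤ)).toNat : ℕ) : ℤ) = x i % (P i : ℤ)
  exact Int.toNat_of_nonneg (Int.emod_nonneg _ hP.ne')

/-- **AT MOST `2^d` FLAT COPIES OF A TORUS BOND IN A BOX OF SIDES `< 2P`**: in a box `[lo, hi]` of `ℤ^d` with `hi_i < lo_i + 2P_i` the flat bonds reading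
on the torus `Π_i ℤ∕P_iℤ` as a given torus bond `b` are at most `2^d` (each coordinate of a copy lies in one of the two halves `[lo_i, lo_i + P_i)`,
`[lo_i + P_i, lo_i + 2P_i)` and is determined by its residue there) — the multiplicity with which the periodic extension ([5] (3.15)) of a torus variation
enters the box of (141). [cite: Balaban1985BackgroundPropagators, (3.15) p.393, (3.137) p.423] [cite: Balaban1985Averaging, (141) p.39] -/
theorem card_filter_bondsIn_perSite_le (P : Fin d → ℕ) [∀ i, NeZero (P i)] (lo hi : B7Prop1Explicit.Site d)
    (hside : ∀ i, hi i < lo i + 2 * (P i : ℤ)) (b : Bond d P) :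
    ((bondsIn lo hi).filter fun s => (perSite P s.1, s.2) = b).card ≤ 2 ^ d := by
  classical
  have hP : ∀ i, (0 : ℤ) < (P i : ℤ) := fun i => by exact_mod_cast Nat.pos_of_ne_zero (NeZero.ne (P i))
  let g : B7Prop1Explicit.Site d × Fin d → (Fin d → Bool) := fun s i => decide (lo i + (P i : ℤ) ≤ s.1 i)
  have hinj : Set.InjOn g ↑((bondsIn lo hi).filter fun s => (perSite P s.1, s.2) = b) := by
    intro s hs s' hs' hg
    rw [Finset.coe_filter, Set.mem_setOf_eq, mem_bondsIn] at hs hs'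
    obtain ⟨⟨hsbox, -⟩, hsb⟩ := hs
    obtain ⟨⟨hs'box, -⟩, hs'b⟩ := hs'
    have h2 : s.2 = s'.2 := by
      have := congrArg Prod.snd hsb; have := congrArg Prod.snd hs'b; simp_all
    have h1 : s.1 = s'.1 := by
      funext i
      have hmod : s.1 i % (P i : ℤ) = s'.1 i % (P i : ℤ) := by
        have e1 := perSite_val_cast P s.1 i
        have e2 := perSite_val_cast P s'.1 i
        have hp : perSite P s.1 = perSite P s'.1 := by
          have a1 : perSite P s.1 = b.1 := congrArg Prod.fst hsb
          have a2 : perSite P s'.1 = b.1 := congrArg Prod.fst hs'b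
          rw [a1, a2]
        rw [← e1, ← e2, hp]
      have hdvd : (P i : ℤ) ∣ s.1 i - s'.1 i := Int.ModEq.dvd hmod.symm |> fun h => by simpa using h
      have hgi : decide (lo i + (P i : ℤ) ≤ s.1 i) = decide (lo i + (P i : ℤ) ≤ s'.1 i) := congrFun hg i
      have hlo := (hsbox i).1; have hhi := (hsbox i).2; have hlo' := (hs'box i).1; have hhi' := (hs'box i).2
      have hsd := hside i
      have habs : (s.1 i - s'.1 i).natAbs < (P i : ℤ).natAbs := by
        have : |s.1 i - s'.1 i| < (P i : ℤ) := by
          by_cases hc : lo i + (P i : ℤ) ≤ s.1 i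
          · have hc' : lo i + (P i : ℤ) ≤ s'.1 i := by simpa [hc] using hgi.symm
            rw [abs_lt]; constructor <;> linarith
          · have hc' : ¬ lo i + (P i : ℤ) ≤ s'.1 i := by simpa [hc] using hgi.symm
            rw [not_le] at hc hc'
            rw [abs_lt]; constructor <;> linarith
        have h0 : (0 : ℤ) ≤ (P i : ℤ) := (hP i).le
        zify
        rw [abs_of_nonneg h0]
        exact this
      have := Int.eq_zero_of_dvd_of_natAbs_lt_natAbs hdvd habs
      linarith
    exact Prod.ext h1 h2
  have h := Finset.card_le_card_of_injOn g (fun s _ => Finset.mem_univ (g s)) hinj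
  rw [Finset.card_univ, Fintype.card_fun, Fintype.card_bool, Fintype.card_fin] at h
  exact h


/-- The box of (136) in `ℤ^d` coordinates IS the one-step box of block size `L^k` at the coarse site: `loK L k ŷ = cornerSite (L^k) y` ([4] p. 24's
`B^k(c₋) ∪ B^k(c₊)`). [cite: Balaban1985Averaging, p.24 (after (43)), (2) p.17] -/
theorem loK_eq_cornerSite (L k : ℕ) {m : Fin d → ℕ} (y : TSite d m) :
    loK L k (fun i => ((y i : ℕ) : ℤ)) = B9Eq315QTorus.cornerSite (L ^ k) y := by
  funext i; simp [loK, B9Eq315QTorus.cornerSite]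

/-- … and `bondHiK L k ŷ κ = bondHi (L^k) (cornerSite (L^k) y) κ` (the upper corner of `B^k(c₋) ∪ B^k(c₊)`). [cite: Balaban1985Averaging, p.24 (after (43)), (2) p.17] -/
theorem bondHiK_eq_bondHi (L k : ℕ) {m : Fin d → ℕ} (y : TSite d m) (κ : Fin d) :
    bondHiK L k (fun i => ((y i : ℕ) : ℤ)) κ = B7Prop1Local.bondHi (L ^ k) (B9Eq315QTorus.cornerSite (L ^ k) y) κ := by
  funext i; simp [bondHiK, B7Prop1Local.bondHi, B9Eq315QTorus.cornerSite]

/-- A flat bond of the box of the coarse bond `c = (y, κ)` reads on the torus `T_{L^k m}` in the block `y` or `y + e_κ`. [cite: Balaban1985Averaging, (2) p.17, p.24] -/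
theorem blockCoord_of_mem_boxBonds (L k : ℕ) (m : Fin d → ℕ) [∀ i, NeZero (fineP (L ^ k) m i)] (y : TSite d m) (κ : Fin d)
    {s : B7Prop1Explicit.Site d × Fin d} (hs : s ∈ boxBonds L k (fun i => ((y i : ℕ) : ℤ)) κ) :
    blockCoord (L ^ k) m (perSite (fineP (L ^ k) m) s.1) = y ∨ blockCoord (L ^ k) m (perSite (fineP (L ^ k) m) s.1) = shift κ y := by
  have h := (mem_bondsIn.1 hs).1
  rw [loK_eq_cornerSite, bondHiK_eq_bondHi] at h
  exact blockCoord_perSite_of_inBox (L ^ k) m y κ s.1 h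

/-- The box `B^k(c₋) ∪ B^k(c₊)` of a coarse bond has sides `< 2·(L^k m_i)` on the torus `T_{L^k m}` (`m_i ≥ 1`). [cite: Balaban1985Averaging, (2) p.17, p.24 (after (43))] -/
theorem bondHiK_lt_loK_add (L k : ℕ) (hL : 1 ≤ L) {m : Fin d → ℕ} (hm : ∀ i, 1 ≤ m i) (y : TSite d m) (κ : Fin d) (i : Fin d) :
    bondHiK L k (fun i => ((y i : ℕ) : ℤ)) κ i < loK L k (fun i => ((y i : ℕ) : ℤ)) i + 2 * ((fineP (L ^ k) m i : ℕ) : ℤ) := by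
  have hLk : (1 : ℤ) ≤ (L : ℤ) ^ k := by exact_mod_cast Nat.one_le_pow k L hL
  have hm1 : (1 : ℤ) ≤ (m i : ℤ) := by exact_mod_cast hm i
  have hP : ((fineP (L ^ k) m i : ℕ) : ℤ) = (L : ℤ) ^ k * (m i : ℤ) := by simp [fineP]
  simp only [bondHiK, loK, hP]
  have : (L : ℤ) ^ k ≤ (L : ℤ) ^ k * (m i : ℤ) := le_mul_of_one_le_right (by positivity) hm1
  split_ifs <;> nlinarith

/-- `d₁ ≤ d` between the two blocks `c₋`, `c₊` of a coarse bond on the torus of blocks — the range of the «several j-blocks surrounding Δ(y)» in (3.137).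
[cite: Balaban1985BackgroundPropagators, (3.137) p.423] [cite: Balaban1984PropagatorsII, (2.46) p.231] -/
theorem tdist1_two_blocks_le {m : Fin d → ℕ} [∀ i, NeZero (m i)] (hm : ∀ i, 1 ≤ m i) (y : TSite d m) (κ : Fin d) {a a' : TSite d m}
    (ha : a = y ∨ a = shift κ y) (ha' : a' = y ∨ a' = shift κ y) : tdist1 m (UT.ofSite m a) (UT.ofSite m a') ≤ d := by
  have hstep : tdist1 m (UT.ofSite m y) (UT.ofSite m (shift κ y)) ≤ d := by
    unfold tdist1
    calc ∑ i, ((ccoord m (UT.toSite m (UT.ofSite m y)) (UT.toSite m (UT.ofSite m (shift κ y))) i : ℕ) : ℝ)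
        ≤ ∑ _i : Fin d, (1 : ℝ) := Finset.sum_le_sum fun i _ => by
          exact_mod_cast B9SectCLatticeCarrier.ccoord_shift_le hm κ y i
      _ = d := by simp
  have hd0 : (0 : ℝ) ≤ d := Nat.cast_nonneg d
  rcases ha with rfl | rfl <;> rcases ha' with rfl | rfl
  · rw [tdist1_self]; exact hd0
  · exact hstep
  · rw [tdist1_comm]; exact hstep
  · rw [tdist1_self]; exact hd0

end Geometry

end Literature.MathematicalPhysics.QuantumFieldTheory.Balaban1983to89.Beta.RemainderDelta2TorusForm

end
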